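import Summits.FinalStateConjecture.FinalStateConjecture.Theorems.PhotonSphereChannelsWindowedShellChannelsStubOutVirialStrip
import Summits.FinalStateConjecture.FinalStateConjecture.Theorems.PhotonSphereChannelsWindowedShellChannelsStubConeInfluxTransport

/-!
# Crux `WindowedShellChannels` (stmt-FinalStateConjecture-14085), line `Sketch`, stub `stub_coneInflux` —
# part 2: the influx law on the right of the peak

Sequel to `…StubConeInfluxTransport` (Fréchet-partial bookkeeping; `u` a `C²` solution of
`u_tt − u_xx + Vu = 0`, `V ≥ 0` of class `C¹` with `V′ ≤ 0` on `(xp, ∞)`, all slices `e(t,·)` of the energy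
density of the same finite `lintegral` `E₀`):

* `truncated_influx_le` — for `t₁ ≤ T` and `xp + (T − t₁) ≤ X₀`,
  `2∫_{t₁}^{T} (u_t + u_x)²(t, xp + (t − t₁)) dt + ∬_{t₁<t≤T, xp+(t−t₁)<x≤X₀} (−V′)u² ≤ ∫_{x>xp} ε(t₁,·)`:
  in the trapezoid identity with outer end `X ≥ X₀` the terminal term is nonnegative, the bulk increases
  with `X`, and the lateral flux `∫_{t₁}^{T} j(·,X) ≤ 2∫_{t₁}^{T} e(·,X)` is an integrable function of `X`
  (Tonelli on the time strip, `integrableOn_timeStrip`), hence small somewhere beyond any `X₀`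
  (`exists_lt_of_integrableOn`);
* `right_influx_le` (= registered sub-goal `stub_coneInflux_right`) — monotone convergence over the
  exhaustions `(t₁, t₁ + n]`, `{t₁ < t ≤ t₁ + n, xp + (t − t₁) < x ≤ xp + 2n}` (`iUnion_trapezoid`):
  `∫⁻_{t>t₁} (u_t + u_x)²(t, xp + (t − t₁)) + ½∬_{t>t₁, x−xp>t−t₁} |V′|u² ≤ ½∫⁻_{x>xp} [(u_t + u_x)² + Vu²](t₁,·)`
  in `[0, ∞]`.

Part 3 (`…StubConeInflux`) translates to the curried vocabulary of the stub and adds the mirror image.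
Standard material [folklore].
-/

noncomputable section

set_option linter.dupNamespace false

namespace Summit.FinalStateConjecture.FinalStateConjecture.Theorems.WindowedShellChannelsSketch

open Filter Set MeasureTheory
open scoped ENNReal Topology

namespace ConeInflux

/-! ### Integrability from finite energy -/

/-- A function integrable on a right half-line takes values below any `δ > 0` beyond any point of it
(otherwise it would dominate the constant `δ` on a set of infinite volume). -/
theorem exists_lt_of_integrableOn {h : ℝ → ℝ} {X₀ δ : ℝ} (hh : IntegrableOn h (Ioi X₀)) (hδ : 0 < δ) :
    ∃ X, X₀ < X ∧ h X < δ := by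
  by_contra! hcon
  have hconst : IntegrableOn (fun _ => δ) (Ioi X₀) :=
    hh.mono' aestronglyMeasurable_const (ae_restrict_of_forall_mem measurableSet_Ioi fun X hX => by
      rw [Real.norm_eq_abs, abs_of_pos hδ]
      exact hcon X hX)
  rw [integrableOn_const_iff] at hconst
  rcases hconst with h0 | htop
  · rw [enorm_eq_zero] at h0
    exact hδ.ne' h0
  · rw [Real.volume_Ioi] at htop
    exact lt_irrefl _ htop

section Energy

variable {u : ℝ × ℝ → ℝ} {V : ℝ → ℝ}

/-- Tonelli on a time strip `(a, b] × ℝ`: if every slice `e(t, ·)` of the (continuous, nonnegative) energy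
density has the same finite `lintegral` `E₀`, then `e` is integrable on the strip. -/
theorem integrableOn_timeStrip (hu : ContDiff ℝ 2 u) (hVd : Differentiable ℝ V) (hV0 : ∀ x, 0 ≤ V x)
    {e : ℝ × ℝ → ℝ}
    (he : ∀ z, e z = (fderiv ℝ u z (1, 0)) ^ 2 + (fderiv ℝ u z (0, 1)) ^ 2 + V z.2 * u z ^ 2)
    {E₀ : ℝ≥0∞} (hE₀ : E₀ ≠ ⊤) (hcons : ∀ t, ∫⁻ x, ENNReal.ofReal (e (t, x)) = E₀) (a b : ℝ) :
    IntegrableOn e (Ioc a b ×ˢ univ) := by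
  have hc := WaveEnergy.continuous_energyDensity hu hVd he
  have hm : Measurable fun z => ENNReal.ofReal (e z) := ENNReal.measurable_ofReal.comp hc.measurable
  refine ⟨hc.aestronglyMeasurable, ?_⟩
  rw [hasFiniteIntegral_iff_ofReal (ae_of_all _ fun z => WaveEnergy.energyDensity_nonneg hV0 he z),
    Measure.volume_eq_prod, ← Measure.restrict_prod_eq_prod_univ, lintegral_prod _ hm.aemeasurable]
  simp only [hcons, lintegral_const, Measure.restrict_apply_univ, Real.volume_Ioc]
  exact ENNReal.mul_lt_top hE₀.lt_top ENNReal.ofReal_lt_top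

/-- Fubini: the time integral over `(a, b]` of a function integrable on the strip `(a, b] × ℝ` is an
integrable function of `x`. -/
theorem integrable_timeIntegral {f : ℝ × ℝ → ℝ} {a b : ℝ} (hint : IntegrableOn f (Ioc a b ×ˢ univ)) :
    Integrable (fun x => ∫ τ in Ioc a b, f (τ, x)) := by
  rw [IntegrableOn, Measure.volume_eq_prod, ← Measure.restrict_prod_eq_prod_univ] at hint
  exact hint.integral_prod_right

end Energy

/-! ### The influx law on the right of the peak -/

section Right

variable {u : ℝ × ℝ → ℝ} {V V' : ℝ → ℝ}

/-- **Truncated right influx inequality.** `V ≥ 0` of class `C¹` with `V′ ≤ 0` on `(xp, ∞)`, `u` a `C²`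
solution all of whose slices have the same finite energy `E₀`, `t₁ ≤ T`, `xp + (T − t₁) ≤ X₀`:
`2∫_{t₁}^{T} (u_t + u_x)²(t, xp + (t − t₁)) dt + ∬_{t₁<t≤T, xp+(t−t₁)<x≤X₀} (−V′)u² ≤ ∫_{x>xp} ε(t₁,·)`,
`ε = (u_t + u_x)² + Vu²`.  From `trapezoid_identity` with outer end `X ≥ X₀`: the terminal term
`∫_{xp+(T−t₁)}^{X} ε(T,·)` is nonnegative, the bulk increases with `X`, `∫_{xp}^{X} ε(t₁,·) ≤ ∫_{x>xp} ε(t₁,·)`,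
and the lateral flux `∫_{t₁}^{T} j(·,X) ≤ 2∫_{t₁}^{T} e(·,X)` is dominated by an integrable function of `X`
(Tonelli), which takes arbitrarily small values (`exists_lt_of_integrableOn`). -/
theorem truncated_influx_le (hu : ContDiff ℝ 2 u) (hV : ∀ x, HasDerivAt V (V' x) x)
    (hV'c : Continuous V') (hV0 : ∀ x, 0 ≤ V x)
    (hsol : ∀ z : ℝ × ℝ, fderiv ℝ (fderiv ℝ u) z (1, 0) (1, 0)
      - fderiv ℝ (fderiv ℝ u) z (0, 1) (0, 1) + V z.2 * u z = 0)
    {xp : ℝ} (hV'R : ∀ x, xp < x → V' x ≤ 0) {e : ℝ × ℝ → ℝ}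
    (he : ∀ z, e z = (fderiv ℝ u z (1, 0)) ^ 2 + (fderiv ℝ u z (0, 1)) ^ 2 + V z.2 * u z ^ 2)
    {E₀ : ℝ≥0∞} (hE₀ : E₀ ≠ ⊤) (hcons : ∀ t, ∫⁻ x, ENNReal.ofReal (e (t, x)) = E₀)
    {t₁ T X₀ : ℝ} (hT : t₁ ≤ T) (hX₀ : xp + (T - t₁) ≤ X₀) :
    2 * (∫ t in t₁..T, (fderiv ℝ u (t, xp + (t - t₁)) (1, 0)
          + fderiv ℝ u (t, xp + (t - t₁)) (0, 1)) ^ 2)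
      + (∫ z in {z : ℝ × ℝ | z.1 ∈ Ioc t₁ T ∧ z.2 ∈ Ioc (xp + (z.1 - t₁)) X₀}, -(V' z.2 * u z ^ 2))
    ≤ ∫ x in Ioi xp, ((fderiv ℝ u (t₁, x) (1, 0) + fderiv ℝ u (t₁, x) (0, 1)) ^ 2
        + V x * u (t₁, x) ^ 2) := by
  have hVd : Differentiable ℝ V := fun x => (hV x).differentiableAt
  obtain ⟨ε, hε⟩ : ∃ ε : ℝ × ℝ → ℝ, ∀ z, ε z
      = (fderiv ℝ u z (1, 0) + fderiv ℝ u z (0, 1)) ^ 2 + V z.2 * u z ^ 2 := ⟨_, fun _ => rfl⟩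
  obtain ⟨j, hj⟩ : ∃ j : ℝ × ℝ → ℝ, ∀ z, j z
      = (fderiv ℝ u z (1, 0) + fderiv ℝ u z (0, 1)) ^ 2 - V z.2 * u z ^ 2 := ⟨_, fun _ => rfl⟩
  obtain ⟨hεd, hjd, -⟩ := eps_transport hu hV hsol hε hj
  have hec := WaveEnergy.continuous_energyDensity hu hVd he
  have hu0 := WaveEnergy.differentiable_of_contDiff_two hu
  -- pointwise facts
  have hε0 : ∀ z, 0 ≤ ε z := fun z => by
    rw [hε]
    exact add_nonneg (sq_nonneg _) (mul_nonneg (hV0 _) (sq_nonneg _))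
  have hεle : ∀ z, ε z ≤ 2 * e z := fun z => by
    rw [hε, he]
    nlinarith [sq_nonneg (fderiv ℝ u z (1, 0) - fderiv ℝ u z (0, 1)),
      mul_nonneg (hV0 z.2) (sq_nonneg (u z))]
  have hjle : ∀ z, j z ≤ 2 * e z := fun z => by
    rw [hj, he]
    nlinarith [sq_nonneg (fderiv ℝ u z (1, 0) - fderiv ℝ u z (0, 1)),
      mul_nonneg (hV0 z.2) (sq_nonneg (u z))]
  have hw0 : ∀ z : ℝ × ℝ, xp < z.2 → 0 ≤ -(V' z.2 * u z ^ 2) := fun z hz =>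
    neg_nonneg.2 (mul_nonpos_of_nonpos_of_nonneg (hV'R z.2 hz) (sq_nonneg _))
  -- integrability
  have hIe : ∀ t, Integrable (fun x => e (t, x)) := fun t =>
    OutVirial.integrable_slice hu hVd hV0 he (by rw [hcons]; exact hE₀.lt_top)
  have hIε : IntegrableOn (fun x => ε (t₁, x)) (Ioi xp) := by
    have hc1 : Continuous fun x => ε (t₁, x) := hεd.continuous.comp (Continuous.prodMk_right t₁)
    refine (((hIe t₁).const_mul 2).mono' hc1.aestronglyMeasurable
      (ae_of_all _ fun x => ?_)).integrableOn
    rw [Real.norm_eq_abs, abs_of_nonneg (hε0 _)]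
    exact hεle _
  have hh : Integrable fun X => ∫ t in Ioc t₁ T, e (t, X) :=
    integrable_timeIntegral (integrableOn_timeStrip hu hVd hV0 he hE₀ hcons t₁ T)
  have hDc : Continuous fun z : ℝ × ℝ => -(V' z.2 * u z ^ 2) :=
    ((hV'c.comp continuous_snd).mul (hu0.continuous.pow 2)).neg
  -- the truncated regions
  set R : ℝ → Set (ℝ × ℝ) := fun Y =>
    {z : ℝ × ℝ | z.1 ∈ Ioc t₁ T ∧ z.2 ∈ Ioc (xp + (z.1 - t₁)) Y} with hR
  have hRm : ∀ Y, MeasurableSet (R Y) := fun Y => by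
    have h1 : MeasurableSet {z : ℝ × ℝ | t₁ < z.1} := measurableSet_lt measurable_const measurable_fst
    have h2 : MeasurableSet {z : ℝ × ℝ | z.1 ≤ T} := measurableSet_le measurable_fst measurable_const
    have h3 : MeasurableSet {z : ℝ × ℝ | xp + (z.1 - t₁) < z.2} :=
      measurableSet_lt (by fun_prop) measurable_snd
    have h4 : MeasurableSet {z : ℝ × ℝ | z.2 ≤ Y} := measurableSet_le measurable_snd measurable_const
    convert ((h1.inter h2).inter h3).inter h4 using 1
    ext z
    simp only [hR, mem_setOf_eq, mem_Ioc, mem_inter_iff]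
    tauto
  have hRx : ∀ Y, ∀ z ∈ R Y, xp < z.2 := fun Y z hz => by
    have h1 : t₁ < z.1 := hz.1.1
    have h2 : xp + (z.1 - t₁) < z.2 := hz.2.1
    linarith
  have hRint : ∀ Y, IntegrableOn (fun z : ℝ × ℝ => -(V' z.2 * u z ^ 2)) (R Y) := fun Y => by
    have hsub : R Y ⊆ Icc t₁ T ×ˢ Icc xp Y := by
      rintro ⟨t, x⟩ hz
      have hx := hRx Y _ hz
      exact ⟨⟨hz.1.1.le, hz.1.2⟩, hx.le, hz.2.2⟩
    exact (hDc.continuousOn.integrableOn_compact (isCompact_Icc.prod isCompact_Icc)).mono_set hsub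
  -- the identity and the three bounds, for every outer end `X ≥ X₀`
  have hmain : ∀ X, X₀ ≤ X →
      2 * (∫ t in t₁..T, (fderiv ℝ u (t, xp + (t - t₁)) (1, 0)
          + fderiv ℝ u (t, xp + (t - t₁)) (0, 1)) ^ 2)
        + (∫ z in R X, -(V' z.2 * u z ^ 2))
      ≤ (∫ x in Ioi xp, ε (t₁, x)) + 2 * ∫ t in Ioc t₁ T, e (t, X) := by
    intro X hXX
    have hX : xp + (T - t₁) ≤ X := hX₀.trans hXX
    have key : (∫ x in (xp + (T - t₁))..X, ε (T, x)) - (∫ x in xp..X, ε (t₁, x))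
        - (∫ z in R X, V' z.2 * u z ^ 2)
        = (∫ t in t₁..T, j (t, X))
          - ∫ t in t₁..T, 2 * (fderiv ℝ u (t, xp + (t - t₁)) (1, 0)
            + fderiv ℝ u (t, xp + (t - t₁)) (0, 1)) ^ 2 :=
      trapezoid_identity hu hV hV'c hsol hε hj hT hX
    have ha : 0 ≤ ∫ x in (xp + (T - t₁))..X, ε (T, x) :=
      intervalIntegral.integral_nonneg hX fun x _ => hε0 _
    have hb : (∫ x in xp..X, ε (t₁, x)) ≤ ∫ x in Ioi xp, ε (t₁, x) := by
      rw [intervalIntegral.integral_of_le (by linarith : xp ≤ X)]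
      exact setIntegral_mono_set hIε (ae_of_all _ fun x => hε0 _) Ioc_subset_Ioi_self.eventuallyLE
    have hc : (∫ t in t₁..T, j (t, X)) ≤ 2 * ∫ t in Ioc t₁ T, e (t, X) := by
      rw [← intervalIntegral.integral_of_le hT, ← intervalIntegral.integral_const_mul]
      exact intervalIntegral.integral_mono_on hT
        ((hjd.continuous.comp (Continuous.prodMk_left X)).intervalIntegrable _ _)
        ((continuous_const.mul (hec.comp (Continuous.prodMk_left X))).intervalIntegrable _ _)
        fun t _ => hjle (t, X)
    have hd : (∫ z in R X, -(V' z.2 * u z ^ 2)) = -∫ z in R X, V' z.2 * u z ^ 2 :=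
      integral_neg _
    have hk : (∫ t in t₁..T, 2 * (fderiv ℝ u (t, xp + (t - t₁)) (1, 0)
        + fderiv ℝ u (t, xp + (t - t₁)) (0, 1)) ^ 2)
        = 2 * ∫ t in t₁..T, (fderiv ℝ u (t, xp + (t - t₁)) (1, 0)
          + fderiv ℝ u (t, xp + (t - t₁)) (0, 1)) ^ 2 :=
      intervalIntegral.integral_const_mul _ _
    linarith
  -- the bulk increases with the outer end
  have hmono : ∀ X, X₀ ≤ X →
      (∫ z in R X₀, -(V' z.2 * u z ^ 2)) ≤ ∫ z in R X, -(V' z.2 * u z ^ 2) := fun X hXX =>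
    setIntegral_mono_set (hRint X)
      (ae_restrict_of_forall_mem (hRm X) fun z hz => hw0 z (hRx X z hz))
      (Eventually.of_forall fun z hz => ⟨hz.1, hz.2.1, hz.2.2.trans hXX⟩)
  -- let the outer end escape to `+∞` through points of small lateral flux
  have hfold : ∀ x, (fderiv ℝ u (t₁, x) (1, 0) + fderiv ℝ u (t₁, x) (0, 1)) ^ 2
      + V x * u (t₁, x) ^ 2 = ε (t₁, x) := fun x => by rw [hε]
  simp_rw [hfold]
  refine le_of_forall_pos_lt_add fun δ hδ => ?_
  obtain ⟨X, hXX, hXδ⟩ := exists_lt_of_integrableOn (X₀ := X₀)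
    ((hh.const_mul 2).integrableOn (s := Ioi X₀)) hδ
  have h1 := hmain X hXX.le
  have h2 := hmono X hXX.le
  linarith

/-- `(t₁, ∞)` is exhausted by the intervals `(t₁, t₁ + n]` and the right exterior of the cone
`{t₁ < t, t − t₁ < x − xp}` by the truncated trapezoids `{t₁ < t ≤ t₁ + n, xp + (t − t₁) < x ≤ xp + 2n}`. -/
theorem iUnion_trapezoid (t₁ xp : ℝ) :
    (⋃ n : ℕ, {z : ℝ × ℝ | z.1 ∈ Ioc t₁ (t₁ + n) ∧ z.2 ∈ Ioc (xp + (z.1 - t₁)) (xp + 2 * n)})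
      = {z : ℝ × ℝ | t₁ < z.1 ∧ z.1 - t₁ < z.2 - xp} := by
  ext ⟨t, x⟩
  simp only [mem_iUnion, mem_setOf_eq, mem_Ioc]
  constructor
  · rintro ⟨n, ⟨h1, -⟩, h3, -⟩
    exact ⟨h1, by linarith⟩
  · rintro ⟨h1, h2⟩
    obtain ⟨n, hn⟩ := exists_nat_ge (max (t - t₁) (x - xp))
    refine ⟨n, ⟨h1, ?_⟩, by linarith, ?_⟩
    · linarith [le_max_left (t - t₁) (x - xp)]
    · linarith [le_max_right (t - t₁) (x - xp), le_max_left (t - t₁) (x - xp)]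

/-- **The right influx law** (Fréchet form, all terms in `[0, ∞]`): `V ≥ 0` of class `C¹` with `V′ ≤ 0` on
`(xp, ∞)`, `u` a `C²` solution with slices of constant finite energy `E₀`, any apex time `t₁`:
`∫⁻_{t>t₁} (u_t + u_x)²(t, xp + (t − t₁)) + ½∬_{t>t₁, x−xp>t−t₁} |V′|u² ≤ ½∫⁻_{x>xp} [(u_t + u_x)² + Vu²](t₁,·)`
(monotone convergence over the exhaustions of `iUnion_trapezoid`, each level being `truncated_influx_le`). -/
theorem right_influx_le (hu : ContDiff ℝ 2 u) (hV : ∀ x, HasDerivAt V (V' x) x)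
    (hV'c : Continuous V') (hV0 : ∀ x, 0 ≤ V x)
    (hsol : ∀ z : ℝ × ℝ, fderiv ℝ (fderiv ℝ u) z (1, 0) (1, 0)
      - fderiv ℝ (fderiv ℝ u) z (0, 1) (0, 1) + V z.2 * u z = 0)
    {xp : ℝ} (hV'R : ∀ x, xp < x → V' x ≤ 0) {e : ℝ × ℝ → ℝ}
    (he : ∀ z, e z = (fderiv ℝ u z (1, 0)) ^ 2 + (fderiv ℝ u z (0, 1)) ^ 2 + V z.2 * u z ^ 2)
    {E₀ : ℝ≥0∞} (hE₀ : E₀ ≠ ⊤) (hcons : ∀ t, ∫⁻ x, ENNReal.ofReal (e (t, x)) = E₀) (t₁ : ℝ) :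
    (∫⁻ t in Ioi t₁, ENNReal.ofReal ((fderiv ℝ u (t, xp + (t - t₁)) (1, 0)
        + fderiv ℝ u (t, xp + (t - t₁)) (0, 1)) ^ 2))
      + (∫⁻ z in {z : ℝ × ℝ | t₁ < z.1 ∧ z.1 - t₁ < z.2 - xp},
          ENNReal.ofReal (2⁻¹ * (|V' z.2| * u z ^ 2)))
    ≤ ∫⁻ x in Ioi xp, ENNReal.ofReal (2⁻¹ * ((fderiv ℝ u (t₁, x) (1, 0)
        + fderiv ℝ u (t₁, x) (0, 1)) ^ 2 + V x * u (t₁, x) ^ 2)) := by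
  have hVd : Differentiable ℝ V := fun x => (hV x).differentiableAt
  have hu0 := WaveEnergy.differentiable_of_contDiff_two hu
  -- the kinetic edge density
  obtain ⟨k, hk⟩ : ∃ k : ℝ → ℝ, ∀ t, k t = (fderiv ℝ u (t, xp + (t - t₁)) (1, 0)
      + fderiv ℝ u (t, xp + (t - t₁)) (0, 1)) ^ 2 := ⟨_, fun _ => rfl⟩
  have hkc : Continuous k := by
    rw [show k = _ from funext hk]
    have h1 := WaveEnergy.continuous_fderiv_apply hu (1, 0)
    have h2 := WaveEnergy.continuous_fderiv_apply hu (0, 1)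
    have hγ : Continuous fun t : ℝ => ((t, xp + (t - t₁)) : ℝ × ℝ) := by fun_prop
    exact ((h1.comp hγ).add (h2.comp hγ)).pow 2
  have hk0 : ∀ t, 0 ≤ k t := fun t => by rw [hk]; exact sq_nonneg _
  simp_rw [← hk]
  -- the exhaustions
  set R : ℕ → Set (ℝ × ℝ) := fun n =>
    {z : ℝ × ℝ | z.1 ∈ Ioc t₁ (t₁ + n) ∧ z.2 ∈ Ioc (xp + (z.1 - t₁)) (xp + 2 * n)} with hR
  have hRm : ∀ n, MeasurableSet (R n) := fun n => by
    have h1 : MeasurableSet {z : ℝ × ℝ | t₁ < z.1} := measurableSet_lt measurable_const measurable_fst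
    have h2 : MeasurableSet {z : ℝ × ℝ | z.1 ≤ t₁ + n} :=
      measurableSet_le measurable_fst measurable_const
    have h3 : MeasurableSet {z : ℝ × ℝ | xp + (z.1 - t₁) < z.2} :=
      measurableSet_lt (by fun_prop) measurable_snd
    have h4 : MeasurableSet {z : ℝ × ℝ | z.2 ≤ xp + 2 * n} :=
      measurableSet_le measurable_snd measurable_const
    convert ((h1.inter h2).inter h3).inter h4 using 1
    ext z
    simp only [hR, mem_setOf_eq, mem_Ioc, mem_inter_iff]
    tauto
  have hRmono : Monotone R := fun i j hij z hz => by
    have hij' : (i : ℝ) ≤ j := Nat.cast_le.mpr hij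
    exact ⟨⟨hz.1.1, hz.1.2.trans (by linarith)⟩, hz.2.1, hz.2.2.trans (by linarith)⟩
  have hImono : Monotone fun n : ℕ => Ioc t₁ (t₁ + n) := fun i j hij =>
    Ioc_subset_Ioc le_rfl (by simpa using hij)
  have hK : (∫⁻ t in Ioi t₁, ENNReal.ofReal (k t))
      = ⨆ n : ℕ, ∫⁻ t in Ioc t₁ (t₁ + n), ENNReal.ofReal (k t) := by
    rw [← WaveEnergy.iUnion_Ioc_add_nat t₁, setLIntegral_iUnion_of_directed _ hImono.directed_le]
  have hB : (∫⁻ z in {z : ℝ × ℝ | t₁ < z.1 ∧ z.1 - t₁ < z.2 - xp},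
      ENNReal.ofReal (2⁻¹ * (|V' z.2| * u z ^ 2)))
      = ⨆ n : ℕ, ∫⁻ z in R n, ENNReal.ofReal (2⁻¹ * (|V' z.2| * u z ^ 2)) := by
    rw [← iUnion_trapezoid t₁ xp, setLIntegral_iUnion_of_directed _ hRmono.directed_le]
  rw [hK, hB, ENNReal.iSup_add_iSup_of_monotone (fun i j hij => lintegral_mono_set (hImono hij))
    (fun i j hij => lintegral_mono_set (hRmono hij))]
  refine iSup_le fun n => ?_
  -- at level `n` everything is a real number
  have hn0 : (0 : ℝ) ≤ n := n.cast_nonneg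
  have hTn : t₁ ≤ t₁ + n := by linarith
  have hXn : xp + (t₁ + n - t₁) ≤ xp + 2 * n := by linarith
  have hreal := truncated_influx_le hu hV hV'c hV0 hsol hV'R he hE₀ hcons hTn hXn
  simp_rw [← hk] at hreal
  have hRx : ∀ z ∈ R n, xp < z.2 := fun z hz => by
    have h1 : t₁ < z.1 := hz.1.1
    have h2 : xp + (z.1 - t₁) < z.2 := hz.2.1
    linarith
  have hDc : Continuous fun z : ℝ × ℝ => -(V' z.2 * u z ^ 2) :=
    ((hV'c.comp continuous_snd).mul (hu0.continuous.pow 2)).neg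
  have hRint : IntegrableOn (fun z : ℝ × ℝ => -(V' z.2 * u z ^ 2)) (R n) := by
    have hsub : R n ⊆ Icc t₁ (t₁ + n) ×ˢ Icc xp (xp + 2 * n) := by
      rintro ⟨t, x⟩ hz
      have hx := hRx _ hz
      exact ⟨⟨hz.1.1.le, hz.1.2⟩, hx.le, hz.2.2⟩
    exact (hDc.continuousOn.integrableOn_compact (isCompact_Icc.prod isCompact_Icc)).mono_set hsub
  have hBn : (∫⁻ z in R n, ENNReal.ofReal (2⁻¹ * (|V' z.2| * u z ^ 2)))
      = ENNReal.ofReal (2⁻¹ * ∫ z in R n, -(V' z.2 * u z ^ 2)) := by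
    have hcongr : EqOn (fun z : ℝ × ℝ => ENNReal.ofReal (2⁻¹ * (|V' z.2| * u z ^ 2)))
        (fun z => ENNReal.ofReal (2⁻¹ * -(V' z.2 * u z ^ 2))) (R n) := fun z hz => by
      simp only [abs_of_nonpos (hV'R z.2 (hRx z hz)), neg_mul]
    rw [setLIntegral_congr_fun (hRm n) hcongr, ← integral_const_mul,
      ← ofReal_integral_eq_lintegral_ofReal (hRint.const_mul _)
        (ae_restrict_of_forall_mem (hRm n) fun z hz =>
          mul_nonneg (by norm_num) (neg_nonneg.2
            (mul_nonpos_of_nonpos_of_nonneg (hV'R z.2 (hRx z hz)) (sq_nonneg _))))]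
  -- the right-hand side is a real number (finite energy at time `t₁`)
  obtain ⟨ε₁, hε₁⟩ : ∃ ε₁ : ℝ → ℝ, ∀ x, ε₁ x = (fderiv ℝ u (t₁, x) (1, 0)
      + fderiv ℝ u (t₁, x) (0, 1)) ^ 2 + V x * u (t₁, x) ^ 2 := ⟨_, fun _ => rfl⟩
  simp_rw [← hε₁] at hreal ⊢
  have hε₁0 : ∀ x, 0 ≤ ε₁ x := fun x => by
    rw [hε₁]
    exact add_nonneg (sq_nonneg _) (mul_nonneg (hV0 _) (sq_nonneg _))
  have hIε₁ : IntegrableOn ε₁ (Ioi xp) := by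
    have hIe : Integrable (fun x => e (t₁, x)) :=
      OutVirial.integrable_slice hu hVd hV0 he (by rw [hcons]; exact hE₀.lt_top)
    have hc : Continuous ε₁ := by
      rw [show ε₁ = _ from funext hε₁]
      have h1 := WaveEnergy.continuous_fderiv_apply hu (1, 0)
      have h2 := WaveEnergy.continuous_fderiv_apply hu (0, 1)
      have hγ : Continuous fun x : ℝ => ((t₁, x) : ℝ × ℝ) := by fun_prop
      exact (((h1.comp hγ).add (h2.comp hγ)).pow 2).add
        (hVd.continuous.mul ((hu0.continuous.comp hγ).pow 2))
    refine ((hIe.const_mul 2).mono' hc.aestronglyMeasurable (ae_of_all _ fun x => ?_)).integrableOn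
    rw [Real.norm_eq_abs, abs_of_nonneg (hε₁0 _), hε₁, he]
    nlinarith [sq_nonneg (fderiv ℝ u (t₁, x) (1, 0) - fderiv ℝ u (t₁, x) (0, 1)),
      mul_nonneg (hV0 x) (sq_nonneg (u (t₁, x)))]
  have hIn : (∫⁻ x in Ioi xp, ENNReal.ofReal (2⁻¹ * ε₁ x))
      = ENNReal.ofReal (2⁻¹ * ∫ x in Ioi xp, ε₁ x) := by
    rw [← integral_const_mul, ← ofReal_integral_eq_lintegral_ofReal (hIε₁.const_mul _)
      (ae_of_all _ fun x => mul_nonneg (by norm_num) (hε₁0 x))]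
  rw [WaveEnergy.lintegral_Ioc_eq_ofReal_intervalIntegral hkc hk0 hTn, hBn, hIn,
    ← ENNReal.ofReal_add (intervalIntegral.integral_nonneg hTn fun t _ => hk0 t)
      (mul_nonneg (by norm_num) (setIntegral_nonneg (hRm n) fun z hz => neg_nonneg.2
        (mul_nonpos_of_nonpos_of_nonneg (hV'R z.2 (hRx z hz)) (sq_nonneg _))))]
  exact ENNReal.ofReal_le_ofReal (by linarith)

end Right


/-- **Registered sub-goal `stub_coneInflux_right` of stub `stub_coneInflux`** (crux
stmt-FinalStateConjecture-14085, line `Sketch`): the right influx law in closed form (`right_influx_le`).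
[folklore] -/
theorem stub_coneInflux_right :
    ∀ (u : ℝ × ℝ → ℝ) (V V' : ℝ → ℝ), ContDiff ℝ 2 u → (∀ x, HasDerivAt V (V' x) x) → Continuous V' →
      (∀ x, 0 ≤ V x) →
      (∀ z : ℝ × ℝ, fderiv ℝ (fderiv ℝ u) z (1, 0) (1, 0) - fderiv ℝ (fderiv ℝ u) z (0, 1) (0, 1)
      + V z.2 * u z = 0) →
      ∀ xp : ℝ, (∀ x, xp < x → V' x ≤ 0) →
      ∀ e : ℝ × ℝ → ℝ,
      (∀ z, e z = (fderiv ℝ u z (1, 0)) ^ 2 + (fderiv ℝ u z (0, 1)) ^ 2 + V z.2 * u z ^ 2) →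
      ∀ E₀ : ENNReal, E₀ ≠ ⊤ → (∀ t, ∫⁻ x, ENNReal.ofReal (e (t, x)) = E₀) → ∀ t₁ : ℝ,
      (∫⁻ t in Set.Ioi t₁, ENNReal.ofReal ((fderiv ℝ u (t, xp + (t - t₁)) (1, 0)
      + fderiv ℝ u (t, xp + (t - t₁)) (0, 1)) ^ 2))
      + (∫⁻ z in {z : ℝ × ℝ | t₁ < z.1 ∧ z.1 - t₁ < z.2 - xp}, ENNReal.ofReal (2⁻¹ * (|V' z.2| * u z ^ 2)))
      ≤ ∫⁻ x in Set.Ioi xp, ENNReal.ofReal (2⁻¹ * ((fderiv ℝ u (t₁, x) (1, 0)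
      + fderiv ℝ u (t₁, x) (0, 1)) ^ 2 + V x * u (t₁, x) ^ 2)) :=
  fun _ _ _ hu hV hV'c hV0 hsol _ hV'R _ he _ hE₀ hcons t₁ =>
    right_influx_le hu hV hV'c hV0 hsol hV'R he hE₀ hcons t₁

end ConeInflux

end Summit.FinalStateConjecture.FinalStateConjecture.Theorems.WindowedShellChannelsSketch

end
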